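import Summits.CriticalPhenomena.PercolationContinuityZ3.Theorems.PercNearOneGluingNoHeavyLowerTailHullPortTANDefs
import HarnessLib

/-!
# `NoHeavyLowerTail` (stmt-CriticalPhenomena-4575) — set-observer marker dominance: the conditional test function (definitions)

Definitions file (prover `prim-hp-7`; `--supports stmt-CriticalPhenomena-4575`).  Second half (blueprint steps B3–B4 of
prim-cplus-coupling's A5-COUPLING-gen13.md §4 (4c)–(4d), refereed in prim-hp-7's FROM-prim-hp-7-g29-REFEREE-MDLSET.md §2)
of the Lean proof of the SET-OBSERVER marker dominance lemma (towards Kozma–Nitzan's Question 9 at `|A| = 3`).  The test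
variable of that lemma, `ζ_N = 1{s ↔ N} · 1{N ↮ X}`, is not a function of the cluster `C_s`; prim-lit-3's reduction
theorem (`BHK2006_clusterConditionalCov_nonneg_of_within…`, `TwoClusterGibbsCovariance.lean`) is applied to its
conditional expectation given `C_s` on `{s ↮ X}`.  This file names the three objects involved (sum-level bookkeeping of
`…HullPortTADefs`, `BHK2006.weight`, `DecisionTree.ind`):
* `hitN s N` — the edge clusters `A` of `s` whose vertex set `{s} ∪ V(A)` meets `N` (`1{s ↔ N}` read on `C_s`);
* `missN N X` — the edge clusters `B` of `X` whose vertex set `X ∪ V(B)` misses `N` (`1{N ↮ X}` read on `C_X`);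
* `zetaBarN w s N X A = 1{A ∈ hitN s N} · Σ_η w(η) 1{N ↮ X}(η ∖ Ā)`, `Ā` the pairs meeting `{s} ∪ V(A)` —
  `E[ζ_N | C_s = A]` on `{s ↮ X}` (given `C_s = A` the configuration off `Ā` is fresh, BHK's display (10)).
[cite: VandenbergHaggstromKahn2005, §1 pp. 7–8 (display (10)), §2.1 Lemma 2.4 (p. 10) — bookkeeping]
[cite: KozmaNitzan2024, Question 9 (p. 36)]
-/

noncomputable section

namespace Summit.CriticalPhenomena.PercolationContinuityZ3.Theorems

open MeasureTheory Set Literature.Probability.LatticeModels Literature.Probability.Percolation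
open scoped Classical

variable {V : Type*}

namespace HullPort

open BHK2006 DecisionTree

section TANWithin

variable [Fintype V]

/-- The edge clusters `A` of `s` whose vertex set `{s} ∪ V(A)` meets `N`: `C_s(ω) ∈ hitN s N ↔ s ↔ N`. [folklore] -/
def hitN (s : V) (N : Set V) : Set (Set (Sym2 V)) := {A | ∃ n ∈ N, n = s ∨ ∃ e ∈ A, n ∈ e}

/-- The edge clusters `B` of `X` whose vertex set `X ∪ V(B)` misses `N`: `C_X(ω) ∈ missN N X ↔ N ↮ X`. [folklore] -/
def missN (N X : Set V) : Set (Set (Sym2 V)) := {B | ∀ n ∈ N, ¬ (n ∈ X ∨ ∃ e ∈ B, n ∈ e)}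

/-- `ζ̄_N(A) = 1{A ∈ hitN s N} · Σ_η w(η) 1{N ↮ X}(η ∖ Ā)`, `Ā = {e | ∃ v ∈ e, v = s ∨ ∃ e' ∈ A, v ∈ e'}`: the conditional
expectation of `1{s ↔ N} · 1{N ↮ X}` given `C_s = A`, on `{s ↮ X}`. (transcription of the cell memo prim-hp-7
FROM-prim-hp-7-g29-REFEREE-MDLSET.md §2, `ζ̄`) [folklore] -/
def zetaBarN (w : Sym2 V → ℝ) (s : V) (N X : Set V) (A : Set (Sym2 V)) : ℝ :=
  ind (hitN s N) A * ∑ η, weight w η * ind (sepEv N X) (η \ {e | ∃ v ∈ e, v = s ∨ ∃ e' ∈ A, v ∈ e'})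

end TANWithin

end HullPort

end Summit.CriticalPhenomena.PercolationContinuityZ3.Theorems
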